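import Literature.NumberTheory.LFunctions.ZetaOneLineRiemannSiegel
import Literature.NumberTheory.LFunctions.ZetaOneLineBounds
import Literature.NumberTheory.LFunctions.TuringMethodTrudgianIILehmanCheck
import HarnessLib

/-!
# Trudgian 2016, Theorem 1 (Turing's method II): the discharge

Topic `Literature/NumberTheory/LFunctions`.  The named fact
`Literature.NumberTheory.LFunctions.abs_integral_zetaArgS_le_trudgianII` (`TuringMethod.lean`;
T. S. Trudgian, *Improvements to Turing's method II*, Rocky Mountain J. Math. 46 (2016), Thm 1:
`|∫_{t₁}^{t₂} S(t) dt| ≤ 1.698 + 0.183 log log t₂ + 0.049 log t₂` for `t₂ > t₁ > 10⁵`) is PROVED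
(`abs_integral_zetaArgS_le_trudgianII_holds`).  Ingredients, all theorems of the tree:

* Turing's lemma `π∫S = U(t₂) − U(t₁)` (`ZetaArgVariation.lean`);
* the upper bound for `U(t) = ∫_{1/2}^∞ log|ζ(σ+it)| dσ` by Rademacher–Phragmén–Lindelöf
  between `σ = ½`, `σ = 1`, `σ = 1+δ` in the sharp form of `TuringMethodTrudgianII.lean`
  ([Trudgian2016, Lemmas 1–2, Thm 2]);
* on `σ = ½`, Lehman's `|ζ(½+it)| ≤ 2.53 t^{1/4}` (`LehmanCriticalLineBoundProofs.lean`);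
* on `σ = 1`, `trudgianII_H2_holds` below: `|ζ₁(1+iu)| ≤ 0.71 |10⁴+1+iu| log|10⁴+1+iu|`, from
  the Riemann–Siegel bound `|ζ(1+it)| ≤ ½ log t + 1.85` (`t ≥ 128π`, `ZetaOneLineRiemannSiegel.lean`)
  and Titchmarsh's Theorem 3.5 (`ZetaOneLineBounds.lean`) below `128π`;
* the lower bound [Trudgian2011, Lemma 2.11] with Booker's `log 4` (`TuringLowerBound.lean`,
  `BookerLemmaProofs.lean`);
* the chain of `19` links `(δ, d)` over `log t₂ ∈ [11.5, ∞)` with certified numerics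
  (`TuringMethodTrudgianIILehman.lean`, evaluated in `TuringMethodTrudgianIILehmanCheck.lean`).

The proof differs from the paper's in its inputs on the two lines (the paper quotes Platt–Trudgian's
`0.732 t^{1/6} log t` and Trudgian's `¾ log t`, whose published proofs rest on the flawed
Cheng–Graham constant, cf. [Patel2022, §1–2]) and accordingly in the choice of `(δ, d)`, which here
depends on `t₂`; the statement is the printed one.  Axioms: the standard three plus the
`native_decide` auxiliary of `TrudgianIIChain.chainCheck_eq_true` (a `computational` proposal).

## References

* T. S. Trudgian, *Improvements to Turing's method II*, Rocky Mountain J. Math. 46 (2016),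
  325–332, Thm 1.  [Trudgian2016]
* T. S. Trudgian, *Improvements to Turing's method*, Math. Comp. 80 (2011), 2259–2279.
  [Trudgian2011]
* D. Patel, *An explicit upper bound for `|ζ(1+it)|`*, Indag. Math. 33 (2022), 1012–1032.
  [Patel2022]
-/

noncomputable section

open Complex Real

namespace Literature.NumberTheory.LFunctions

/-- **The edge hypothesis `H2` of the chain, PROVED** (`k₄ = 0.71`, `Q₀ = 10⁴`):
`|ζ₁(1+iu)| ≤ 0.71 |10⁴+1+iu| log|10⁴+1+iu|` for all real `u`.  Three ranges: `|u| < 3` by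
Titchmarsh (2.12.2) (`|ζ₁| ≤ 16`); `3 ≤ |u| ≤ 128π` by Titchmarsh's Theorem 3.5 with the tree's
constant (`|ζ(1+iu)| ≤ 21 log|u| ≤ 126`,
`Literature.NumberTheory.LFunctions.ZetaOneLine.norm_riemannZeta_le_log`); `|u| > 128π` by the
Riemann–Siegel bound `|ζ(1+iu)| ≤ ½ log|u| + 1.85`
(`Literature.NumberTheory.LFunctions.SiegelIntegral.norm_riemannZeta_one_add_le_half_log`) and
`½ log N + 1.85 ≤ 0.71 log N` for `N ≥ 10⁴ + 1`. [cite: Trudgian2016, Lemma 1] -/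
theorem trudgianII_H2_holds (u : ℝ) :
    ‖riemannZeta₁ (1 + u * I)‖ ≤
      0.71 * ‖((10000 : ℝ) : ℂ) + (1 + u * I)‖ * Real.log ‖((10000 : ℝ) : ℂ) + (1 + u * I)‖ := by
  have hπ := Real.pi_pos
  have hπ3 : 3.1415 < π := Real.pi_gt_d4
  have hπ4 : π < 3.1416 := Real.pi_lt_d4
  set s : ℂ := 1 + u * I with hs
  set N : ℝ := ‖((10000 : ℝ) : ℂ) + s‖ with hN
  have e2 : ((10000 : ℝ) : ℂ) + s = ((10000 + 1 : ℝ) : ℂ) + u * I := by simp [hs]; ring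
  have hNre : (10000 + 1 : ℝ) ≤ N := by
    rw [hN, e2]
    refine le_trans ?_ (abs_re_le_norm _)
    simp only [add_re, ofReal_re, mul_re, I_re, I_im, ofReal_im, mul_zero, mul_one, sub_self,
      add_zero]
    exact le_abs_self _
  have hNu : |u| ≤ N := by
    rw [hN, e2]
    refine le_trans ?_ (abs_im_le_norm _)
    simp
  have hN0 : 0 < N := by linarith
  have hlogN : (9.2 : ℝ) ≤ Real.log N := by
    have h10 : (9.2 : ℝ) ≤ Real.log (10000 + 1) := by
      rw [Real.le_log_iff_exp_le (by norm_num)]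
      have h1 := Real.exp_one_lt_d9
      have e : Real.exp 9.2 = Real.exp 1 ^ 9 * Real.exp 0.2 := by
        rw [← Real.exp_nat_mul, ← Real.exp_add]; norm_num
      have h02 : Real.exp 0.2 ≤ 1.2215 := by
        have := Real.exp_bound' (x := 0.2) (by norm_num) (by norm_num) (n := 4) (by norm_num)
        norm_num [Finset.sum_range_succ] at this
        linarith
      rw [e]
      have h9 : Real.exp 1 ^ 9 ≤ 2.7182818286 ^ 9 := pow_le_pow_left₀ (Real.exp_pos 1).le h1.le 9
      have := mul_le_mul h9 h02 (Real.exp_pos _).le (by positivity)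
      refine this.trans ?_
      norm_num
    exact h10.trans (Real.log_le_log (by norm_num) hNre)
  have hsre : s.re = 1 := by simp [hs]
  have hsim : s.im = u := by simp [hs]
  -- `‖ζ₁(s)‖ = |u| ‖ζ(s)‖` off `u = 0`
  have hsm1 : ‖s - 1‖ = |u| := by
    have : s - 1 = u * I := by simp [hs]
    rw [this, norm_mul, Complex.norm_I, mul_one, Complex.norm_real, Real.norm_eq_abs]
  rcases lt_or_ge |u| 3 with hu | hu
  · -- small `|u|`: `‖ζ₁‖ ≤ 16`
    have hsre' : (0 : ℝ) < s.re := by rw [hsre]; norm_num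
    have hb := norm_riemannZeta₁_le_of_re_pos hsre'
    rw [hsre, div_one] at hb
    have hn : ‖s‖ ≤ 1 + |u| := by
      calc ‖s‖ ≤ ‖(1 : ℂ)‖ + ‖(u : ℂ) * I‖ := norm_add_le _ _
        _ = 1 + |u| := by
            rw [norm_one, norm_mul, Complex.norm_I, mul_one, Complex.norm_real, Real.norm_eq_abs]
    have hu0 := abs_nonneg u
    calc ‖riemannZeta₁ s‖ ≤ ‖s‖ + ‖s‖ * ‖s - 1‖ := hb
      _ ≤ (1 + |u|) + (1 + |u|) * |u| := by rw [hsm1]; gcongr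
      _ ≤ 16 := by nlinarith
      _ ≤ 0.71 * (10000 + 1) * 9.2 := by norm_num
      _ ≤ 0.71 * N * Real.log N := by
          apply mul_le_mul (mul_le_mul_of_nonneg_left hNre (by norm_num)) hlogN (by norm_num)
          positivity
  · -- `|u| ≥ 3`
    have hu1 : 1 ≤ |u| := le_trans (by norm_num) hu
    have hs1 : s ≠ 1 := fun h' ↦ by
      have := congrArg Complex.im h'; simp [hs] at this; rw [this] at hu1; simp at hu1; linarith
    rw [LFunctions.riemannZeta₁_eq_mul hs1, norm_mul, hsm1]
    rcases le_or_gt |u| (128 * π) with hmid | hlarge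
    · -- `3 ≤ |u| ≤ 128π`: Titchmarsh 3.5 with constant `21`, `log|u| ≤ 6`
      have hζ : ‖riemannZeta s‖ ≤ 21 * Real.log |u| := by
        have h := ZetaOneLine.norm_riemannZeta_le_log (s := s) (by rw [hsim]; exact hu)
          (by
            rw [hsim, hsre]
            have : 0 < Real.log |u| := Real.log_pos (by linarith)
            have : 0 ≤ 1 / (2 * Real.log |u|) := by positivity
            linarith)
        rwa [hsim] at h
      have hlog6 : Real.log |u| ≤ 6 := by
        rw [Real.log_le_iff_le_exp (by linarith)]
        have he := Real.exp_one_gt_d9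
        have e6 : Real.exp 6 = Real.exp 1 ^ 6 := by rw [← Real.exp_nat_mul]; norm_num
        rw [e6]
        have : (2.7182818283 : ℝ) ^ 6 ≤ Real.exp 1 ^ 6 := pow_le_pow_left₀ (by norm_num) he.le 6
        nlinarith
      have hlog0 : 0 ≤ Real.log |u| := Real.log_nonneg hu1
      calc |u| * ‖riemannZeta s‖ ≤ (128 * π) * (21 * Real.log |u|) :=
            mul_le_mul hmid hζ (norm_nonneg _) (by positivity)
        _ ≤ (128 * 3.1416) * (21 * 6) := by
            apply mul_le_mul (by linarith) (by linarith) (by positivity) (by positivity)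
        _ ≤ 0.71 * (10000 + 1) * 9.2 := by norm_num
        _ ≤ 0.71 * N * Real.log N := by
            apply mul_le_mul (mul_le_mul_of_nonneg_left hNre (by norm_num)) hlogN (by norm_num)
            positivity
    · -- `|u| > 128π`: the Riemann–Siegel bound `½ log|u| + 1.85`
      have hζ : ‖riemannZeta s‖ ≤ 1 / 2 * Real.log |u| + 1.85 := by
        rcases le_or_gt 0 u with hu0 | hu0
        · rw [abs_of_nonneg hu0] at hlarge
          have := SiegelIntegral.norm_riemannZeta_one_add_le_half_log hlarge.le
          rwa [abs_of_nonneg hu0]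
        · have h' := SiegelIntegral.norm_riemannZeta_one_add_le_half_log (t := -u)
            (by rw [abs_of_neg hu0] at hlarge; linarith)
          have hc : (1 + ((-u : ℝ) : ℂ) * I) = starRingEnd ℂ s := by
            apply Complex.ext <;> simp [hs]
          rw [hc, riemannZeta_conj, Complex.norm_conj] at h'
          rwa [abs_of_neg hu0]
      have hlogu : Real.log |u| ≤ Real.log N := Real.log_le_log (by linarith) hNu
      calc |u| * ‖riemannZeta s‖ ≤ N * (1 / 2 * Real.log N + 1.85) := by
            apply mul_le_mul hNu (hζ.trans (by linarith)) (norm_nonneg _) hN0.le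
        _ ≤ N * (0.71 * Real.log N) := by
            apply mul_le_mul_of_nonneg_left _ hN0.le
            linarith
        _ = 0.71 * N * Real.log N := by ring

/-- **Trudgian 2016, Theorem 1** — discharge of the named fact
`Literature.NumberTheory.LFunctions.abs_integral_zetaArgS_le_trudgianII`: for all `t₂ > t₁ > 10⁵`,
`|∫_{t₁}^{t₂} S(t) dt| ≤ 1.698 + 0.183 log log t₂ + 0.049 log t₂`
(`S(t) = N(t) − ϑ(t)/π − 1`, `Literature.NumberTheory.LFunctions.zetaArgS`). [cite: Trudgian2016, Thm 1] -/
theorem abs_integral_zetaArgS_le_trudgianII_holds : abs_integral_zetaArgS_le_trudgianII :=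
  abs_integral_zetaArgS_le_trudgianII_of_one_line trudgianII_H2_holds

end Literature.NumberTheory.LFunctions

end
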